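import Literature.Barriers.CriticalPhenomena.LaceExpansionXSpaceNorms
import Mathlib.Analysis.Normed.Group.Tannery
import HarnessLib

/-!
# Hara's `x`-space reduction proved: Lemmas 1.5–1.7 and the Gaussian lemma give
# `|Π_{p_c}(x)| ≤ c⟦x⟧^{-2(d-2)}` (Hara 2008, §1.2.3–§1.2.4, percolation, `d ≥ 11`)

Barrier catalogue `Literature/Barriers/CriticalPhenomena/` (D-0021), companion of
`LaceExpansionXSpaceNorms.lean` (the named facts `Hara2008_lemma15Pc`, `Hara2008_lemma16Pc`,
`Hara2008_lemma17Pc` and Hara's weighted diagrams) and of `LaceExpansionPcInputs.lean` (the split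
`Hara2008_laceExpansionPc ↔ Hara2008_prop12Pc ∧ Hara2008_xSpacePiBoundPc`). Here the `x`-space
half `Hara2008_xSpacePiBoundPc` is PROVED from its printed inputs, following Hara's §1.2.3–§1.2.4:

1. **The recursion** (§1.2.4, percolation): from `Σ_x |x|² |Π(x)| < ∞` (Prop. 1.2), Lemma 1.7
   gives `W̄^{(2,γ)}, T̄^{(0,γ)}, H̄^{(2)} < ∞` and Lemma 1.6 gives `Σ_x |x|^{2+γ}|Π(x)| < ∞`;
   with `γ = ⌊φ⌋ - ε` the exponent grows by one per step until `φ = d - 4 - ε` (we take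
   `ε = 1/4`: `Σ|x|^{n+3/4}|Π| < ∞` for `3 ≤ n ≤ d-5`, `piMoment_iterate`), and Lemma 1.7 gives
   `Ḡ^{(d-4-ε)} < ∞`, i.e. `G(x) ≤ β₀⟦x⟧^{-(d-4-ε)}` — "sufficient … as long as
   `(d+2)/2 < d-4-ε`, or `d > 10`".
2. **First pass of Lemma 1.5**: `|Π(x)| ≤ c₀β₀²⟦x⟧^{-2(d-4-ε)}`, hence
   `|J(x)|, |g(x)| ≤ c⟦x⟧^{-(d+2+ρ)}` with `ρ = (d - 21/2)/2 > 0` for `d ≥ 11`, together with the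
   moment conditions of the Gaussian lemma; `K₁ = Σ|x|²J(x) > 0` from the infrared bound with
   second moments only (`secondMoment_pos_of_lower'`, Lemma 2.1 by dominated convergence —
   the fourth-moment shortcut of `LaceExpansionXSpaceAsymptotics.lean` is not available at
   `d = 11, 12`).
3. **The Gaussian lemma** (Cor. 1.4, the vendored quantitative half `Hara2008_gaussianConvolution`,
   applicable since `ρ > 0`; Hara's text runs this pass through `α = (d+2)/2` and the first half
   of Thm. 1.3) and the representation `G = H` give `G(x) ≤ β₁⟦x⟧^{-(d-2)}`
   (`tau_le_jnorm_of_asymptotics`).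
4. **Second pass of Lemma 1.5**: `|Π(x)| ≤ c₁β₁²⟦x⟧^{-2(d-2)}`.

## Main results (all proved; namespace `Literature.Barriers.CriticalPhenomena`)

* `piMoment_step`, `piMoment_iterate`, `haraGBar_lt_top_of_lemmas` (the recursion);
* `secondMoment_pos_of_lower'` (`K₁ ≥ 2c₁ > 0` with `Σ|x|²|J| < ∞` only);
* `tau_le_of_haraGBar_lt_top`, `tau_le_jnorm_of_asymptotics`, `decay_of_decay_ne_zero`;
* `xSpacePiBound_of_lemmas` (steps 1–4 for one coefficient `Φ` with finite second moment);
* `Hara2008_xSpacePiBoundPc_of_lemmas :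
    Hara2008_prop12Pc → Hara2008_lemma15Pc → Hara2008_lemma16Pc → Hara2008_lemma17Pc →
    Hara2008_gaussianConvolution → Hara2008_xSpacePiBoundPc` (the second moment of the unique
  coefficient comes from Prop. 1.2), `Hara2008_laceExpansionPc_of_lemmas`,
  `Hara2008_etaZeroXSpace_of_lemmas`.

After this file the barrier fact `Hara2008_etaZeroXSpace` (Heydenreich–van der Hofstad 2017,
Thm. 11.4) rests on exactly: `Hara2008_prop12Pc` (the lace expansion at `p_c` in `k`-space:
Hara–Slade 1990, Hara 2008 Prop. 1.2 and App. A, Fitzner–van der Hofstad 2017), the diagrammatic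
Lemmas 1.5–1.6 (`Hara2008_lemma15Pc`, `Hara2008_lemma16Pc`), the analytic Lemma 1.7
(`Hara2008_lemma17Pc`) and the Gaussian lemma Cor. 1.4 (`Hara2008_gaussianConvolution`).

## References

* T. Hara, Ann. Probab. 36 (2008) 530–593 (arXiv:math-ph/0504021): §1.2.2 ("(the first two
  hypotheses of Thm. 1.3) follow directly from Proposition 1.2 at `p = p_c`"), §1.2.3 (Lemma 1.5,
  the two passes), §1.2.4 (Lemmas 1.6–1.7, "Proof of (the sufficient condition) assuming Lemmas
  1.6 and 1.7", the recursion for percolation and "`d > 10`"), Lemma 2.1 and its proof.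
* M. Heydenreich, R. van der Hofstad, *Progress in High-Dimensional Percolation and Random
  Graphs*, Springer 2017: Thm. 11.4, (11.2.5)–(11.2.9), (11.2.13)–(11.2.15), p. 139.
* R. Fitzner, R. van der Hofstad, Electron. J. Probab. 22 (2017) no. 43: Thm. 1.4 and §7.
-/

noncomputable section

namespace Literature.Barriers.CriticalPhenomena

open _root_.MeasureTheory _root_.Filter _root_.Topology Literature.Probability.LatticeModels
  Literature.Probability.Percolation

open scoped ENNReal

variable {d : ℕ}

/-! ### From `Ḡ^{(α)} < ∞` to a bound `G(x) ≤ β ⟦x⟧^{-α}` -/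

/-- **`Ḡ^{(α)} < ∞` is the bound `G(x) ≤ β⟦x⟧^{-α}`**: for `|x| ≥ 1`, `⟦x⟧ = |x|` and
`G(x) = |x|^α G(x)/|x|^α ≤ C/|x|^α`; for `|x| < 1`, `⟦x⟧ = 1` and `G ≤ 1`. (Hara, §1.2.4: "Using
Lemma 1.7 … implies that `Ḡ^{(α)}` is finite with `α = d-4-ε`, or `G(x) = O(|x|^{-(d-4-ε)})`".)
[cite: Hara2008, §1.2.4] -/
theorem tau_le_of_haraGBar_lt_top {α : ℝ} (h : haraGBar d α < ⊤) :
    ∃ β : ℝ, 0 < β ∧ ∀ x : Site d, tau d (criticalProbI d) 0 x ≤ β / jnorm x ^ α := by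
  obtain ⟨C, hC⟩ := le_of_haraGBar_lt_top h
  refine ⟨max C 1, lt_of_lt_of_le one_pos (le_max_right _ _), fun x => ?_⟩
  have hτ1 := tau_le_one (criticalProbI d) 0 x
  have hτ0 := tau_nonneg (criticalProbI d) 0 x
  rcases le_or_gt 1 (euclidNorm x) with h1 | h1
  · rw [jnorm_eq_euclidNorm h1]
    have hpos : 0 < euclidNorm x ^ α := Real.rpow_pos_of_pos (by linarith) α
    rw [le_div_iff₀ hpos]
    have := hC x
    rw [haraG] at this
    calc tau d (criticalProbI d) 0 x * euclidNorm x ^ α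
        = euclidNorm x ^ α * tau d (criticalProbI d) 0 x := mul_comm _ _
      _ ≤ C := this
      _ ≤ max C 1 := le_max_left _ _
  · have hj : jnorm x = 1 := max_eq_right h1.le
    rw [hj, Real.one_rpow, div_one]
    exact hτ1.trans (le_max_right _ _)

/-! ### Side conditions of Lemma 1.7: odd integers and floors -/

/-- `2` is not an odd integer. [folklore] -/
theorem not_isOddInt_two : ¬ IsOddInt 2 := by
  rintro ⟨n, hn⟩
  have h : (2 : ℝ) * n = 1 := by linarith
  have h' : (2 * n : ℤ) = 1 := by exact_mod_cast h
  omega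

/-- `0` is not an odd integer. [folklore] -/
theorem not_isOddInt_zero : ¬ IsOddInt 0 := by
  rintro ⟨n, hn⟩
  have h' : (2 * n : ℤ) + 1 = 0 := by exact_mod_cast hn.symm
  omega

/-- `m - ε` is not an odd integer for an integer `m` and `0 < ε < 1`. [folklore] -/
theorem not_isOddInt_int_sub {m : ℤ} {ε : ℝ} (h0 : 0 < ε) (h1 : ε < 1) :
    ¬ IsOddInt ((m : ℝ) - ε) := by
  rintro ⟨n, hn⟩
  have hε : ε = ((m - 2 * n - 1 : ℤ) : ℝ) := by push_cast; linarith
  have h0' : (0 : ℤ) < m - 2 * n - 1 := by exact_mod_cast hε ▸ h0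
  have h1' : m - 2 * n - 1 < (1 : ℤ) := by exact_mod_cast hε ▸ h1
  omega

/-- `⌊m - ε⌋ = m - 1` for an integer `m` and `0 < ε ≤ 1`. [folklore] -/
theorem floor_int_sub {m : ℤ} {ε : ℝ} (h0 : 0 < ε) (h1 : ε ≤ 1) : ⌊(m : ℝ) - ε⌋ = m - 1 := by
  rw [Int.floor_eq_iff]
  push_cast
  constructor <;> linarith

/-! ### The recursion of §1.2.4 for percolation

"We start from `φ₀ = 2` and choose `β_{i+1} = 2`, `γ_{i+1} = {(d-6) ∧ ⌊φ_i⌋} - ε`,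
`φ_{i+1} = β_{i+1} + γ_{i+1}` … For `d > 6`, repeating this recursion increases `φ_i` until it
reaches `d - 4 - ε`." We run it with `ε = 1/4`: one step takes `Σ|x|^φ|Π| < ∞` (`⌊φ⌋ = n`,
`2 ≤ n ≤ d - 6`, so that `φ ≥ 2`) to `Σ|x|^{n + 7/4}|Π| < ∞`, via Lemma 1.7 for `W̄^{(2, n-1/4)}`,
`T̄^{(0, n-1/4)}`, `H̄^{(2)}` and Lemma 1.6. -/

/-- **One step of the recursion.** [cite: Hara2008, §1.2.4 (proof for percolation, the recursion with β_{i+1} = 2)] -/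
theorem piMoment_step (h16 : Hara2008_lemma16Pc) (h17 : Hara2008_lemma17Pc) (hd : 11 ≤ d)
    {Φ : Site d → ℝ} (hΦ : IsLaceCoefficientPc d Φ) {φ : ℝ} {n : ℤ}
    (hn : ⌊φ⌋ = n) (hn2 : 2 ≤ n) (hnd : n ≤ (d : ℤ) - 6)
    (hmom : Summable fun x : Site d => euclidNorm x ^ φ * |Φ x|) :
    Summable fun x : Site d => euclidNorm x ^ ((n : ℝ) + 7 / 4) * |Φ x| := by
  have hdR : (11 : ℝ) ≤ d := by exact_mod_cast hd
  have hn2R : (2 : ℝ) ≤ n := by exact_mod_cast hn2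
  -- `2 ≤ n = ⌊φ⌋ ≤ φ`: the moment hypothesis of Lemma 1.7 holds with `φ ≥ 2 > 1`
  have hnle : ((n : ℤ) : ℝ) ≤ φ := hn ▸ Int.floor_le φ
  obtain ⟨-, hW, hT, -, hH⟩ := h17 d hd Φ hΦ φ (by linarith) hmom
  have hndR : (n : ℝ) ≤ d - 6 := by
    have : ((n : ℤ) : ℝ) ≤ ((d : ℤ) - 6 : ℤ) := by exact_mod_cast hnd
    push_cast at this
    exact this
  have hnφ : ((⌊φ⌋ : ℤ) : ℝ) = n := by rw [hn]
  set γ : ℝ := (n : ℝ) - 1 / 4 with hγ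
  have hγ0 : 0 ≤ γ := by rw [hγ]; linarith
  have hγodd : ¬ IsOddInt γ := not_isOddInt_int_sub (by norm_num) (by norm_num)
  have hγfloor : (⌊γ⌋ : ℝ) = n - 1 := by
    rw [hγ, floor_int_sub (by norm_num) (by norm_num)]
    push_cast
    ring
  have h2floor : (⌊(2 : ℝ)⌋ : ℝ) = 2 := by norm_num
  have h0floor : (⌊(0 : ℝ)⌋ : ℝ) = 0 := by norm_num
  -- `W̄^{(2,γ)} < ∞`
  have hW' : haraWBar d 2 γ < ⊤ := by
    refine hW 2 γ (by norm_num) hγ0 not_isOddInt_two hγodd ?_ ?_ ?_ ?_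
    · rw [hnφ]; exact hn2R
    · rw [hnφ, hγ]; linarith
    · rw [hγ]; linarith
    · rw [h2floor, hγfloor, hγ]; linarith
  -- `T̄^{(0,γ)} < ∞`
  have hT' : haraTBar d 0 γ < ⊤ := by
    refine hT 0 γ le_rfl hγ0 not_isOddInt_zero hγodd ?_ ?_ ?_ ?_
    · rw [hnφ]; linarith
    · rw [hnφ, hγ]; linarith
    · rw [hγ]; linarith
    · rw [h0floor, hγfloor, hγ]; linarith
  -- `H̄^{(2)} < ∞`
  have hH' : haraHBar d 2 < ⊤ := by
    refine hH 2 (by norm_num) not_isOddInt_two ?_ ?_ (by omega)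
    · rw [hnφ]; exact hn2R
    · linarith
  have h := h16 d hd Φ hΦ 2 γ (by norm_num) hγ0 hW' hT' hH'
  refine h.congr fun x => ?_
  rw [hγ]
  congr 2
  ring

/-- **The recursion, iterated**: `Σ_x |x|^{n + 3/4} |Π(x)| < ∞` for every integer `3 ≤ n ≤ d - 5`,
starting from the second moment `Σ_x |x|² |Π(x)| < ∞` of Prop. 1.2 ("`φ_i` is increased by one
in each iteration, until it finally reaches `d - 4 - ε`").
[cite: Hara2008, §1.2.4 (proof for percolation)] -/
theorem piMoment_iterate (h16 : Hara2008_lemma16Pc) (h17 : Hara2008_lemma17Pc) (hd : 11 ≤ d)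
    {Φ : Site d → ℝ} (hΦ : IsLaceCoefficientPc d Φ)
    (hmom : Summable fun x : Site d => euclidNorm x ^ 2 * |Φ x|) :
    ∀ n : ℕ, 3 ≤ n → n ≤ d - 5 →
      Summable fun x : Site d => euclidNorm x ^ ((n : ℝ) + 3 / 4) * |Φ x| := by
  intro n hn3 hnd
  induction n, hn3 using Nat.le_induction with
  | base =>
    -- from `φ₀ = 2`
    have hmom' : Summable fun x : Site d => euclidNorm x ^ (2 : ℝ) * |Φ x| := by
      refine hmom.congr fun x => ?_
      rw [show (2 : ℝ) = ((2 : ℕ) : ℝ) by norm_num, Real.rpow_natCast]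
    have h := piMoment_step h16 h17 hd hΦ (φ := 2) (n := 2) (by norm_num) le_rfl (by omega) hmom'
    refine h.congr fun x => ?_
    norm_num
  | succ n hn3 ih =>
    have ih' := ih (by omega)
    have hfloor : ⌊(n : ℝ) + 3 / 4⌋ = (n : ℤ) := by
      rw [Int.floor_eq_iff]
      push_cast
      constructor <;> linarith
    have h := piMoment_step h16 h17 hd hΦ hfloor (by omega) (by omega) ih'
    refine h.congr fun x => ?_
    push_cast
    ring_nf

/-- **Output of the recursion**: `Ḡ^{(d-4-ε)} < ∞` with `ε = 1/4`, by Lemma 1.7 with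
`φ = α = d - 4 - 1/4` ("Using Lemma 1.7 with `φ = d-4-ε` implies `Ḡ^{(α)}` is finite with
`α = d-4-ε`"). [cite: Hara2008, §1.2.4 (proof for percolation)] -/
theorem haraGBar_lt_top_of_lemmas (h16 : Hara2008_lemma16Pc) (h17 : Hara2008_lemma17Pc) (hd : 11 ≤ d)
    {Φ : Site d → ℝ} (hΦ : IsLaceCoefficientPc d Φ)
    (hmom : Summable fun x : Site d => euclidNorm x ^ 2 * |Φ x|) :
    haraGBar d ((d : ℝ) - 17 / 4) < ⊤ := by
  have hdR : (11 : ℝ) ≤ d := by exact_mod_cast hd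
  have h := piMoment_iterate h16 h17 hd hΦ hmom (d - 5) (by omega) le_rfl
  have hcast : (((d - 5 : ℕ) : ℝ) + 3 / 4) = (d : ℝ) - 17 / 4 := by
    rw [Nat.cast_sub (by omega)]
    push_cast
    ring
  rw [hcast] at h
  obtain ⟨hG, -, -, -, -⟩ := h17 d hd Φ hΦ ((d : ℝ) - 17 / 4) (by linarith) h
  refine hG ((d : ℝ) - 17 / 4) (by linarith) ?_ le_rfl (by linarith)
  have : (d : ℝ) - 17 / 4 = (((d : ℤ) - 4 : ℤ) : ℝ) - 1 / 4 := by push_cast; ring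
  rw [this]
  exact not_isOddInt_int_sub (by norm_num) (by norm_num)

/-! ### `K₁ = Σ_x |x|² J(x) > 0` from the infrared bound, with second moments only

Hara, §1.2.2: the hypotheses `Ĵ(0) = 1` and `Ĵ(0) - Ĵ(k) ≥ K₀|k|²/(2d)`, `K₁` finite positive of
Thm. 1.3 "follow directly from Proposition 1.2 at `p = p_c`"; Lemma 2.1:
`1 - Ĵ(k) = K₁|k|²/(2d) + o(|k|²)` by dominated convergence. The version
`secondMoment_pos_of_lower` of `LaceExpansionXSpaceAsymptotics.lean` uses the fourth moment; here
only `Σ|x|²|J(x)| < ∞` is assumed, as in Lemma 2.1 (needed for `d = 11, 12`). -/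

/-- `|1 - cos u - u²/2| ≤ u²/2`. [folklore] -/
theorem abs_one_sub_cos_sub_le (u : ℝ) : |1 - Real.cos u - u ^ 2 / 2| ≤ u ^ 2 / 2 := by
  rw [abs_le]
  constructor
  · linarith [one_sub_cos_le u, Real.cos_le_one u, sq_nonneg u]
  · linarith [one_sub_cos_le u, Real.cos_le_one u]

/-- `|1 - cos u - u²/2| ≤ (5/96) u⁴` for `|u| ≤ 1`. [folklore] -/
theorem abs_one_sub_cos_sub_le_pow_four {u : ℝ} (hu : |u| ≤ 1) :
    |1 - Real.cos u - u ^ 2 / 2| ≤ 5 / 96 * u ^ 4 := by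
  have h := Real.cos_bound hu
  rw [show |u| ^ 4 = u ^ 4 by rw [← abs_pow]; exact abs_of_nonneg (by positivity)] at h
  rw [show 1 - Real.cos u - u ^ 2 / 2 = -(Real.cos u - (1 - u ^ 2 / 2)) by ring, abs_neg]
  linarith

/-- **`K₁ > 0` (Hara, Lemma 2.1 with the infrared lower bound)**: for a signed kernel with
`Ĵ(0) = 1`, `Σ_x |x|² |J(x)| < ∞` and `c₁|k|²/d ≤ 1 - Re Ĵ(k)` on `[-π,π]^d` (`c₁ > 0`), the second
moment `K₁ = Σ_x |x|² J(x)` is at least `2c₁ > 0`: at `k = t eᵢ`, summed over `i`,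
`c₁ t² ≤ (t²/2) K₁ + Σ_x Σᵢ J(x){1 - cos(t xᵢ) - (t xᵢ)²/2}`, and the last sum is `o(t²)` by
dominated convergence (`|1 - cos u - u²/2| ≤ u²/2 ∧ (5/96)u⁴`).
[cite: Hara2008, §1.2.2 and Lemma 2.1 (with its proof)] -/
theorem secondMoment_pos_of_lower' (hd : 1 ≤ d) {J : Site d → ℝ} (hJ1 : HasSum J 1)
    (h2 : Summable fun x => euclidNorm x ^ 2 * |J x|) {c₁ : ℝ} (hc₁ : 0 < c₁)
    (hlow : ∀ k ∈ cube d, c₁ * (∑ i, k i ^ 2) / d ≤ 1 - (latticeFT J k).re) :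
    0 < ∑' x, euclidNorm x ^ 2 * J x := by
  have hJabs : Summable fun x => |J x| := hJ1.summable.abs
  set K₁ := ∑' x, euclidNorm x ^ 2 * J x with hK₁_def
  have hK₁sum : Summable fun x => euclidNorm x ^ 2 * J x :=
    Summable.of_norm_bounded h2 fun x => by
      rw [Real.norm_eq_abs, abs_mul, abs_of_nonneg (sq_nonneg _)]
  have hd' : (0 : ℝ) < d := by exact_mod_cast hd
  -- the error terms `E_t(x) = Σ_i J(x) (1 - cos(t x_i) - (t x_i)²/2) / t²`
  set E : ℝ → Site d → ℝ := fun t x =>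
    ∑ i, J x * (1 - Real.cos (t * ((x i : ℤ) : ℝ)) - (t * ((x i : ℤ) : ℝ)) ^ 2 / 2) / t ^ 2 with hE
  -- domination `|E_t(x)| ≤ |x|² |J(x)| / 2`
  have hEb : ∀ t, 0 < t → ∀ x, ‖E t x‖ ≤ euclidNorm x ^ 2 * |J x| / 2 := by
    intro t ht x
    rw [Real.norm_eq_abs, hE]
    dsimp only
    have ht2 : 0 < t ^ 2 := by positivity
    calc |∑ i, J x * (1 - Real.cos (t * ((x i : ℤ) : ℝ)) - (t * ((x i : ℤ) : ℝ)) ^ 2 / 2) / t ^ 2|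
        ≤ ∑ i, |J x * (1 - Real.cos (t * ((x i : ℤ) : ℝ)) - (t * ((x i : ℤ) : ℝ)) ^ 2 / 2) / t ^ 2| :=
          Finset.abs_sum_le_sum_abs _ _
      _ ≤ ∑ i, |J x| * (((x i : ℤ) : ℝ) ^ 2 / 2) := by
          refine Finset.sum_le_sum fun i _ => ?_
          rw [abs_div, abs_mul, abs_of_pos ht2, div_le_iff₀ ht2]
          have h := abs_one_sub_cos_sub_le (t * ((x i : ℤ) : ℝ))
          calc |J x| * |1 - Real.cos (t * ((x i : ℤ) : ℝ)) - (t * ((x i : ℤ) : ℝ)) ^ 2 / 2|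
              ≤ |J x| * ((t * ((x i : ℤ) : ℝ)) ^ 2 / 2) := mul_le_mul_of_nonneg_left h (abs_nonneg _)
            _ = |J x| * (((x i : ℤ) : ℝ) ^ 2 / 2) * t ^ 2 := by ring
      _ = euclidNorm x ^ 2 * |J x| / 2 := by
          rw [← Finset.mul_sum, ← Finset.sum_div, ← euclidNorm_sq]
          ring
  -- pointwise convergence `E_t(x) → 0` as `t ↓ 0`
  have hEt : ∀ x, Tendsto (fun t => E t x) (𝓝[>] 0) (𝓝 0) := by
    intro x
    -- bound `|E_t(x)| ≤ t² · C_x` once `t |x_i| ≤ 1` for all `i`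
    set Cx : ℝ := ∑ i, |J x| * (5 / 96 * ((x i : ℤ) : ℝ) ^ 4) with hCx
    have hM : 0 < euclidNorm x + 1 := by linarith [euclidNorm_nonneg x]
    have hev : ∀ᶠ t in 𝓝[>] (0 : ℝ), |E t x| ≤ t ^ 2 * Cx := by
      filter_upwards [Ioo_mem_nhdsGT (show (0 : ℝ) < 1 / (euclidNorm x + 1) by positivity)]
        with t ht
      have ht0 : 0 < t := ht.1
      have ht2 : 0 < t ^ 2 := by positivity
      have hti : ∀ i, |t * ((x i : ℤ) : ℝ)| ≤ 1 := by
        intro i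
        rw [abs_mul, abs_of_pos ht0]
        have h1 : |((x i : ℤ) : ℝ)| ≤ euclidNorm x := abs_apply_le_euclidNorm x i
        have h2 : t * (euclidNorm x + 1) < 1 := by
          have := ht.2
          rwa [lt_div_iff₀ hM] at this
        nlinarith [abs_nonneg (((x i : ℤ) : ℝ)), euclidNorm_nonneg x]
      rw [hE]
      dsimp only
      calc |∑ i, J x * (1 - Real.cos (t * ((x i : ℤ) : ℝ)) - (t * ((x i : ℤ) : ℝ)) ^ 2 / 2) / t ^ 2|
          ≤ ∑ i, |J x * (1 - Real.cos (t * ((x i : ℤ) : ℝ)) - (t * ((x i : ℤ) : ℝ)) ^ 2 / 2) / t ^ 2| :=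
            Finset.abs_sum_le_sum_abs _ _
        _ ≤ ∑ i, t ^ 2 * (|J x| * (5 / 96 * ((x i : ℤ) : ℝ) ^ 4)) := by
            refine Finset.sum_le_sum fun i _ => ?_
            rw [abs_div, abs_mul, abs_of_pos ht2, div_le_iff₀ ht2]
            have h := abs_one_sub_cos_sub_le_pow_four (hti i)
            calc |J x| * |1 - Real.cos (t * ((x i : ℤ) : ℝ)) - (t * ((x i : ℤ) : ℝ)) ^ 2 / 2|
                ≤ |J x| * (5 / 96 * (t * ((x i : ℤ) : ℝ)) ^ 4) :=
                  mul_le_mul_of_nonneg_left h (abs_nonneg _)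
              _ = t ^ 2 * (|J x| * (5 / 96 * ((x i : ℤ) : ℝ) ^ 4)) * t ^ 2 := by ring
        _ = t ^ 2 * Cx := by rw [hCx, Finset.mul_sum]
    have hlim : Tendsto (fun t : ℝ => t ^ 2 * Cx) (𝓝[>] 0) (𝓝 0) := by
      have : Tendsto (fun t : ℝ => t ^ 2 * Cx) (𝓝 0) (𝓝 (0 ^ 2 * Cx)) :=
        ((continuous_pow 2).mul continuous_const).tendsto 0
      rw [zero_pow two_ne_zero, zero_mul] at this
      exact this.mono_left nhdsWithin_le_nhds
    exact squeeze_zero_norm' (by simpa only [Real.norm_eq_abs] using hev) hlim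
  -- Tannery: `Σ_x E_t(x) → 0`
  have hS : Tendsto (fun t => ∑' x, E t x) (𝓝[>] 0) (𝓝 (∑' x : Site d, (0 : ℝ))) := by
    refine tendsto_tsum_of_dominated_convergence (bound := fun x => euclidNorm x ^ 2 * |J x| / 2)
      (h2.div_const 2) hEt ?_
    exact eventually_nhdsWithin_of_forall fun t ht x => hEb t ht x
  rw [tsum_zero] at hS
  -- the key inequality `c₁ ≤ K₁/2 + Σ_x E_t(x)` for `t ∈ (0, π]`
  have key : ∀ t : ℝ, 0 < t → t ≤ Real.pi → c₁ ≤ K₁ / 2 + ∑' x, E t x := by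
    intro t ht htπ
    have habs : |t| ≤ Real.pi := by rwa [abs_of_pos ht]
    have ht2 : 0 < t ^ 2 := by positivity
    have hi : ∀ i : Fin d, c₁ * t ^ 2 / d ≤ ∑' x, J x * (1 - Real.cos (t * ((x i : ℤ) : ℝ))) := by
      intro i
      have h := hlow (Pi.single i t) (single_mem_cube i habs)
      rw [sum_sq_single, one_sub_re_latticeFT hJ1 hJabs] at h
      simpa only [kdot_single] using h
    have hterm : ∀ i : Fin d, Summable fun x => J x * (1 - Real.cos (t * ((x i : ℤ) : ℝ))) := by
      intro i
      refine Summable.of_norm_bounded (hJabs.mul_right 2) fun x => ?_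
      rw [Real.norm_eq_abs, abs_mul]
      have hc : |1 - Real.cos (t * ((x i : ℤ) : ℝ))| ≤ 2 := by
        rw [abs_le]
        constructor <;>
          linarith [Real.cos_le_one (t * ((x i : ℤ) : ℝ)), Real.neg_one_le_cos (t * ((x i : ℤ) : ℝ))]
      exact mul_le_mul_of_nonneg_left hc (abs_nonneg _)
    have hsum : c₁ * t ^ 2 ≤ ∑' x, ∑ i : Fin d, J x * (1 - Real.cos (t * ((x i : ℤ) : ℝ))) := by
      have h := Finset.sum_le_sum fun i (_ : i ∈ Finset.univ) => hi i
      simp only [Finset.sum_const, Finset.card_univ, Fintype.card_fin, nsmul_eq_mul] at h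
      rw [Summable.tsum_finsetSum fun i _ => hterm i]
      calc c₁ * t ^ 2 = (d : ℝ) * (c₁ * t ^ 2 / d) := by field_simp
        _ ≤ _ := h
    -- split each summand as `(t²/2)|x|²J(x) + t² E_t(x)`
    have hsplit : ∀ x, ∑ i : Fin d, J x * (1 - Real.cos (t * ((x i : ℤ) : ℝ))) =
        t ^ 2 / 2 * (euclidNorm x ^ 2 * J x) + t ^ 2 * E t x := by
      intro x
      rw [hE]
      dsimp only
      rw [euclidNorm_sq, Finset.sum_mul, Finset.mul_sum, Finset.mul_sum, ← Finset.sum_add_distrib]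
      refine Finset.sum_congr rfl fun i _ => ?_
      field_simp
      ring
    have hEs : Summable (E t) := Summable.of_norm_bounded (h2.div_const 2) (hEb t ht)
    rw [tsum_congr hsplit, Summable.tsum_add (hK₁sum.mul_left _) (hEs.mul_left _), tsum_mul_left,
      tsum_mul_left] at hsum
    have : c₁ * t ^ 2 ≤ (K₁ / 2 + ∑' x, E t x) * t ^ 2 := by rw [hK₁_def]; linarith
    exact le_of_mul_le_mul_right this ht2
  -- let `t ↓ 0`
  have hlim : Tendsto (fun t => K₁ / 2 + ∑' x, E t x) (𝓝[>] 0) (𝓝 (K₁ / 2 + 0)) :=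
    tendsto_const_nhds.add hS
  rw [add_zero] at hlim
  have hev : ∀ᶠ t in 𝓝[>] (0 : ℝ), c₁ ≤ K₁ / 2 + ∑' x, E t x := by
    filter_upwards [Ioo_mem_nhdsGT Real.pi_pos] with t ht
    exact key t ht.1 ht.2.le
  have hc : c₁ ≤ K₁ / 2 := ge_of_tendsto hlim hev
  linarith

/-! ### The reduction: Lemmas 1.5–1.7 and the Gaussian lemma give the `x`-space bound -/

/-- A decay bound `|Φ(x)| ≤ C ⟦x⟧^{-s}` off the origin extends to all `x` (with the constant
`max C |Φ(0)|`, since `⟦0⟧ = 1`). [folklore] -/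
theorem decay_of_decay_ne_zero {Φ : Site d → ℝ} {C s : ℝ}
    (h : ∀ x : Site d, x ≠ 0 → |Φ x| ≤ C / jnorm x ^ s) :
    ∀ x : Site d, |Φ x| ≤ max C |Φ 0| / jnorm x ^ s := by
  intro x
  by_cases hx : x = 0
  · subst hx
    simp
  · refine (h x hx).trans ?_
    exact div_le_div_of_nonneg_right (le_max_left _ _) (Real.rpow_nonneg (jnorm_pos x).le s)

/-- **From the Gaussian asymptotics to a global bound `G(x) ≤ β⟦x⟧^{-(d-2)}`** ("Once we have
(the decay of `J`), Theorem 1.3 establishes (the Gaussian behaviour `G(x) ~ const.|x|^{2-d}`) …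
We can then use (it) as an input to Lemma 1.5"): if `|G(x) - M|x|^{2-d}| ≤ K|x|^{-(d-2+δ)}` for
`|x| ≥ R` (`δ ≥ 0`), then for `|x| ≥ R ∨ 1` one has `G(x) ≤ (|M| + |K|)|x|^{2-d}`, and for
`|x| < R ∨ 1`, `G ≤ 1 ≤ (R ∨ 1)^{d-2} ⟦x⟧^{-(d-2)}`. [cite: Hara2008, §1.2.3] -/
theorem tau_le_jnorm_of_asymptotics (hd : 2 ≤ d) {M K R δ : ℝ} (hδ : 0 ≤ δ)
    (h : ∀ x : Site d, R ≤ euclidNorm x →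
      |tau d (criticalProbI d) 0 x - M * euclidNorm x ^ (2 - (d : ℝ))| ≤
        K * euclidNorm x ^ (-((d : ℝ) - 2 + δ))) :
    ∃ β : ℝ, 0 < β ∧ ∀ x : Site d, tau d (criticalProbI d) 0 x ≤ β / jnorm x ^ ((d : ℝ) - 2) := by
  have hdR : (2 : ℝ) ≤ d := by exact_mod_cast hd
  set R₁ : ℝ := max R 1 with hR₁
  have hR₁1 : 1 ≤ R₁ := le_max_right _ _
  have hR₁pow : 1 ≤ R₁ ^ ((d : ℝ) - 2) := Real.one_le_rpow hR₁1 (by linarith)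
  refine ⟨|M| + |K| + R₁ ^ ((d : ℝ) - 2), by positivity, fun x => ?_⟩
  have hτ1 := tau_le_one (criticalProbI d) 0 x
  have hτ0 := tau_nonneg (criticalProbI d) 0 x
  rcases le_or_gt R₁ (euclidNorm x) with h1 | h1
  · -- far from the origin: use the asymptotics
    have hx1 : 1 ≤ euclidNorm x := hR₁1.trans h1
    have hxR : R ≤ euclidNorm x := (le_max_left _ _).trans h1
    have hxpos : 0 < euclidNorm x := by linarith
    rw [jnorm_eq_euclidNorm hx1]
    have hb := h x hxR
    have hmain : tau d (criticalProbI d) 0 x ≤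
        |M| * euclidNorm x ^ (2 - (d : ℝ)) + |K| * euclidNorm x ^ (2 - (d : ℝ)) := by
      have e1 : M * euclidNorm x ^ (2 - (d : ℝ)) ≤ |M| * euclidNorm x ^ (2 - (d : ℝ)) :=
        mul_le_mul_of_nonneg_right (le_abs_self M) (Real.rpow_nonneg hxpos.le _)
      have e2 : K * euclidNorm x ^ (-((d : ℝ) - 2 + δ)) ≤ |K| * euclidNorm x ^ (2 - (d : ℝ)) := by
        calc K * euclidNorm x ^ (-((d : ℝ) - 2 + δ))
            ≤ |K| * euclidNorm x ^ (-((d : ℝ) - 2 + δ)) :=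
              mul_le_mul_of_nonneg_right (le_abs_self K) (Real.rpow_nonneg hxpos.le _)
          _ ≤ |K| * euclidNorm x ^ (2 - (d : ℝ)) :=
              mul_le_mul_of_nonneg_left
                (Real.rpow_le_rpow_of_exponent_le hx1 (by linarith)) (abs_nonneg K)
      have e3 := (abs_le.1 hb).2
      linarith
    have hpow : euclidNorm x ^ (2 - (d : ℝ)) = 1 / euclidNorm x ^ ((d : ℝ) - 2) := by
      rw [show (2 : ℝ) - d = -((d : ℝ) - 2) by ring, Real.rpow_neg hxpos.le, one_div]
    rw [hpow] at hmain
    have hxpow : 0 < euclidNorm x ^ ((d : ℝ) - 2) := Real.rpow_pos_of_pos hxpos _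
    rw [le_div_iff₀ hxpow]
    rw [← add_mul, mul_one_div, le_div_iff₀ hxpow] at hmain
    have hR : 0 ≤ R₁ ^ ((d : ℝ) - 2) := by positivity
    linarith
  · -- near the origin: `G ≤ 1`
    have hj1 := one_le_jnorm x
    have hjR : jnorm x ≤ R₁ := max_le h1.le hR₁1
    have hjpow : jnorm x ^ ((d : ℝ) - 2) ≤ R₁ ^ ((d : ℝ) - 2) :=
      Real.rpow_le_rpow (jnorm_pos x).le hjR (by linarith)
    have hjpos : 0 < jnorm x ^ ((d : ℝ) - 2) := Real.rpow_pos_of_pos (jnorm_pos x) _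
    rw [le_div_iff₀ hjpos]
    have hMK : 0 ≤ |M| + |K| := by positivity
    nlinarith

/-- **Hara's `x`-space reduction, proved** (§1.2.3–§1.2.4 for percolation, `d ≥ 11`): for a
lace-expansion coefficient `Φ` with finite second moment, Lemmas 1.5, 1.6, 1.7 and the Gaussian
lemma (Cor. 1.4) give `|Π(x)| ≤ c⟦x⟧^{-2(d-2)}`. Route: the recursion gives `Ḡ^{(d-4-ε)} < ∞`
(`ε = 1/4`), i.e. `G ≤ β₀⟦x⟧^{-(d-4-ε)}`; Lemma 1.5 gives `|Π(x)| ≤ c₀β₀²⟦x⟧^{-2(d-4-ε)}`, whence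
`|J|, |g| ≤ c⟦x⟧^{-(d+2+ρ)}` with `ρ = (d - 21/2)/2 > 0` and the moment conditions of Cor. 1.4
(`K₁ > 0` by `secondMoment_pos_of_lower'`); Cor. 1.4 with the representation `G = H` gives
`G ≤ β₁⟦x⟧^{-(d-2)}`; Lemma 1.5 again gives the claim. (Hara runs the first pass through
`α = (d+2)/2` and the first half of Thm. 1.3; the quantitative Cor. 1.4, already vendored, serves
as well since `ρ > 0` for `d ≥ 11`.)
[cite: Hara2008, §1.2.3 (Lemma 1.5, the two passes) and §1.2.4 (the recursion, "d > 10")] -/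
theorem xSpacePiBound_of_lemmas (hd : 11 ≤ d) {Φ : Site d → ℝ} (hΦ : IsLaceCoefficientPc d Φ)
    (hmom : Summable fun x : Site d => euclidNorm x ^ 2 * |Φ x|)
    (h15 : Hara2008_lemma15Pc) (h16 : Hara2008_lemma16Pc) (h17 : Hara2008_lemma17Pc)
    (hG : Hara2008_gaussianConvolution) :
    ∃ c : ℝ, ∀ x : Site d, |Φ x| ≤ c / jnorm x ^ (2 * ((d : ℝ) - 2)) := by
  have hdR : (11 : ℝ) ≤ d := by exact_mod_cast hd
  have hd1 : 1 ≤ d := by omega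
  have hd3 : 3 ≤ d := by omega
  set p : ℝ := (criticalProbI d : ℝ) with hp
  set g := laceSource Φ with hg_def
  set J := laceKernel p Φ with hJ_def
  -- Step 1: the recursion and Lemma 1.7 give `G ≤ β₀ ⟦x⟧^{-(d - 17/4)}`
  set α₀ : ℝ := (d : ℝ) - 17 / 4 with hα₀
  obtain ⟨β₀, hβ₀, hτ₀⟩ := tau_le_of_haraGBar_lt_top (haraGBar_lt_top_of_lemmas h16 h17 hd hΦ hmom)
  -- Step 2: Lemma 1.5 at `α₀`
  obtain ⟨c₀, hc₀⟩ := h15 d hd Φ hΦ α₀ (by rw [hα₀]; linarith) (by rw [hα₀]; linarith)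
  set s : ℝ := 2 * α₀ with hs
  have hΦ₀ : ∀ x, |Φ x| ≤ max (c₀ * β₀ ^ 2) |Φ 0| / jnorm x ^ s :=
    decay_of_decay_ne_zero fun x hx => hc₀ β₀ hβ₀ hτ₀ x hx
  set C₀ : ℝ := max (c₀ * β₀ ^ 2) |Φ 0| with hC₀
  have hC₀nn : 0 ≤ C₀ := le_max_of_le_right (abs_nonneg _)
  have hsnn : 0 ≤ s := by rw [hs, hα₀]; linarith
  -- Step 3: decay and moments of `J`, `g`; the hypotheses of Cor. 1.4 with `ρ = (d - 21/2)/2`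
  set ρ : ℝ := ((d : ℝ) - 21 / 2) / 2 with hρ
  have hρpos : 0 < ρ := by rw [hρ]; linarith
  have hgb : ∀ x, |g x| ≤ (1 + C₀) / jnorm x ^ s := abs_laceSource_le hΦ₀
  have hJb : ∀ y, |J y| ≤ (2 * d * |p| * (2 ^ s * (1 + C₀))) / jnorm y ^ s :=
    abs_laceKernel_le hΦ₀ hsnn p
  set CJ : ℝ := 2 * d * |p| * (2 ^ s * (1 + C₀)) with hCJ
  have hCJnn : 0 ≤ CJ := by positivity
  have hsd : (d : ℝ) + 2 + ρ ≤ s := by rw [hs, hα₀, hρ]; linarith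
  have hg_abs : Summable fun x => |g x| := summable_abs_of_decay hgb (by rw [hs, hα₀]; linarith)
  have hJ2 : Summable fun x => euclidNorm x ^ (2 : ℝ) * |J x| :=
    summable_rpow_mul_abs_of_decay hJb (by norm_num) (by rw [hs, hα₀]; linarith)
  have hJ2' : Summable fun x => euclidNorm x ^ 2 * |J x| := by
    refine hJ2.congr fun x => ?_
    rw [show (2 : ℝ) = ((2 : ℕ) : ℝ) by norm_num, Real.rpow_natCast]
  have hJρ : Summable fun x => euclidNorm x ^ (2 + ρ) * |J x| :=
    summable_rpow_mul_abs_of_decay hJb (by linarith) (by rw [hs, hα₀, hρ]; linarith)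
  obtain ⟨c₁, hc₁, hlow⟩ := hΦ.lower
  have hK₁ : 0 < ∑' x, euclidNorm x ^ 2 * J x :=
    secondMoment_pos_of_lower' hd1 hΦ.hasSum_one hJ2' hc₁ hlow
  have hKer : HaraKernelHyp d J ρ :=
    { symm := isZdSymmetric_laceKernel hΦ.symm p
      rho_pos := hρpos
      hasSum_one := hΦ.hasSum_one
      lower := ⟨2 * c₁, by positivity, fun k hk => by
        have h := hlow k hk
        calc 2 * c₁ * (∑ i, k i ^ 2) / (2 * d) = c₁ * (∑ i, k i ^ 2) / d := by
              field_simp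
          _ ≤ _ := h⟩
      secondMoment_pos := hK₁
      summable_sq := hJ2'
      decay := ⟨CJ, fun x => (hJb x).trans (div_jnorm_rpow_mono hCJnn (by linarith))⟩
      summable_rho := hJρ
      decay_rho := ⟨CJ, fun x => (hJb x).trans (div_jnorm_rpow_mono hCJnn hsd)⟩ }
  have hSrc : HaraSourceHyp d g ρ :=
    { symm := isZdSymmetric_laceSource hΦ.symm
      summable := hg_abs
      decay := ⟨1 + C₀, fun x =>
        (hgb x).trans (div_jnorm_rpow_mono (by linarith) (by linarith))⟩
      decay_rho := ⟨1 + C₀, fun x =>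
        (hgb x).trans (div_jnorm_rpow_mono (by linarith) (by linarith))⟩ }
  obtain ⟨-, K, R, hKR⟩ := hG d hd3 J g ρ hKer hSrc
  -- Step 4: the representation `G = H` turns the asymptotics into `G ≤ β₁ ⟦x⟧^{-(d-2)}`
  set M : ℝ := (∑' y, g y) / (∑' y, euclidNorm y ^ 2 * J y) * gaussianAmp d with hM
  have hasym : ∀ x : Site d, R ≤ euclidNorm x →
      |tau d (criticalProbI d) 0 x - M * euclidNorm x ^ (2 - (d : ℝ))| ≤
        K * euclidNorm x ^ (-((d : ℝ) - 2 + min ρ 2 / d)) := by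
    intro x hx
    have h := hKR x hx
    rw [← hΦ.repr x, ← Complex.ofReal_sub, Complex.norm_real, Real.norm_eq_abs] at h
    exact h
  obtain ⟨β₁, hβ₁, hτ₁⟩ := tau_le_jnorm_of_asymptotics (by omega) (by positivity) hasym
  -- Step 5: Lemma 1.5 at `α = d - 2`
  obtain ⟨c₂, hc₂⟩ := h15 d hd Φ hΦ ((d : ℝ) - 2) (by linarith) (by linarith)
  refine ⟨max (c₂ * β₁ ^ 2) |Φ 0|, fun x => ?_⟩
  have h := decay_of_decay_ne_zero (fun x hx => hc₂ β₁ hβ₁ hτ₁ x hx) x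
  exact h

/-- **The `x`-space half from its printed inputs**: `Hara2008_prop12Pc` (for the second
moment of the — unique — coefficient), Lemmas 1.5–1.7 and Cor. 1.4 give
`Hara2008_xSpacePiBoundPc`. [cite: Hara2008, §1.2.3–§1.2.4] -/
theorem Hara2008_xSpacePiBoundPc_of_lemmas (h₁ : Hara2008_prop12Pc) (h15 : Hara2008_lemma15Pc)
    (h16 : Hara2008_lemma16Pc) (h17 : Hara2008_lemma17Pc) (hG : Hara2008_gaussianConvolution) :
    Hara2008_xSpacePiBoundPc := by
  intro d hd Φ hΦ
  obtain ⟨Ψ, hΨ, hmomΨ⟩ := h₁ d hd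
  have heq : Φ = Ψ := hΦ.unique (by omega) hΨ
  subst heq
  exact xSpacePiBound_of_lemmas hd hΦ hmomΨ h15 h16 h17 hG

/-- **`Hara2008_laceExpansionPc` from Prop. 1.2 at `p_c`, Lemmas 1.5–1.7 and Cor. 1.4.**
[cite: Hara2008, §1.2 (framework of the proof of Thm. 1.1)] -/
theorem Hara2008_laceExpansionPc_of_lemmas (h₁ : Hara2008_prop12Pc) (h15 : Hara2008_lemma15Pc)
    (h16 : Hara2008_lemma16Pc) (h17 : Hara2008_lemma17Pc) (hG : Hara2008_gaussianConvolution) :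
    Hara2008_laceExpansionPc :=
  Hara2008_laceExpansionPc_of_inputs h₁ (Hara2008_xSpacePiBoundPc_of_lemmas h₁ h15 h16 h17 hG)

/-- **`η = 0` in `x`-space (`Hara2008_etaZeroXSpace`, Heydenreich–van der Hofstad 2017,
Thm. 11.4) from the printed inputs of Hara's proof**: Prop. 1.2 at `p = p_c`, the diagrammatic
Lemmas 1.5–1.6, the analytic Lemma 1.7 and the Gaussian lemma Cor. 1.4 — everything else
(§1.2.2–§1.2.4 of Hara 2008) being proved in this library.
[cite: Hara2008, §1.2 (framework of the proof of Thm. 1.1)]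
[cite: HeydenreichVanDerHofstad2017, Thm. 11.4 and pp. 137–139] -/
theorem Hara2008_etaZeroXSpace_of_lemmas (h₁ : Hara2008_prop12Pc) (h15 : Hara2008_lemma15Pc)
    (h16 : Hara2008_lemma16Pc) (h17 : Hara2008_lemma17Pc) (hG : Hara2008_gaussianConvolution) :
    Hara2008_etaZeroXSpace :=
  Hara2008_etaZeroXSpace_of_framework hG (Hara2008_laceExpansionPc_of_lemmas h₁ h15 h16 h17 hG)

end Literature.Barriers.CriticalPhenomena
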